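import Literature.Probability.LatticeModels.SharpLengthDCPProofs
import Literature.Probability.LatticeModels.CriticalTwoPointDCPLowerFromReflected
import HarnessLib

/-!
# Duminil-Copin–Panis 2025: `L(β_c) = ∞`, and Theorem 1.3 in the near-critical range from
# Theorem 1.2 in the near-critical range (the printed deduction, proved for `β ≤ β_c`)

Topic `Literature/Probability/LatticeModels`; family `crit-ising`. Theorem-only companion of
`SharpLengthDCP.lean` (Def. 1.1 = `sharpLength`, eq. (1.4) = `dcp_nearCritical_upper`, Thm. 1.3
near-critical = `dcp_twoPoint_axis_lower_nearCritical`) and of `CriticalTwoPointDCPLower.lean`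
(Thm. 1.2 / Thm. 1.3 at `β_c` = `dcp_reflectedGradient_lower` / `dcp_criticalTwoPoint_axis_lower`),
for H. Duminil-Copin, R. Panis, *New lower bounds for the (near) critical Ising and φ⁴ models'
two-point functions*, CMP 406 (2025) = arXiv:2404.05700 (held: `paper:arxiv-2404.05700`).
No definition, no named fact (D-0026); everything below is proved.

1. **`L(β_c) = ∞`** (`sharpLength_criticalBeta_eq_top`, `d ≥ 3`). The source uses this
   tacitly (it applies Theorem 1.2 at `β_c` "for `n` large enough", proof of Theorem 1.8, p. 7).
   Proof: if `L(β_c) = ℓ < ∞`, eq. (1.4) — PROVED in `SharpLengthDCPProofs.lean`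
   (`dcp_nearCritical_upper_holds`) — gives `⟨σ₀σ_{ne₁}⟩_{β_c} ≤ C ℓ^{2-d} e^{-cn/ℓ}` for `n ≥ ℓ`,
   contradicting Simon's lower bound `⟨σ₀σ_{ne₁}⟩_{β_c} ≥ c' n^{1-d}` (`criticalTwoPoint_bounds_holds`,
   with `μ⁺_{β_c} = μ^f_{β_c}` on pairs, `twoPointPlus_criticalBeta_eq_twoPointFree_holds`) as
   `n → ∞`. Consequently the `β = β_c` slice of the near-critical Theorem 1.3 is the critical
   Theorem 1.3 unconditionally (`dcp_criticalTwoPoint_axis_lower_of_nearCritical'`).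
2. **Theorem 1.3 from Theorem 1.2 in the near-critical range**
   (`dcp_twoPoint_axis_lower_of_reflectedGradient_nearCritical`). Hypothesis: Theorem 1.2 AS
   PRINTED ("there exist `c₀, N₀ > 0` such that for all `β ≤ β_c` and for all `N₀ ≤ n ≤ L(β)`,
   `β ∑_{x,y ∈ Λ_n, y∼x} (⟨τ₀τ_x⟩_β - ⟨τ₀τ_{𝓡_n(x)}⟩_β)⟨τ_yτ_{𝓡_n(y)}⟩_β ≥ c₀`"), rendered exactly
   like the tree's `β_c` fact `dcp_reflectedGradient_lower` (same double sum over `box d n`, same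
   `dcpReflect`, same pair correlation `freeExpect d β 0 (spinPair y (𝓡_n y))`) but for every
   `0 ≤ β ≤ β_c`, with the printed factor `β` and the printed range `(n : ℕ∞) ≤ sharpLength d β`
   — it is NOT vendored as a named fact here (that is for the seat that proves it; its `β_c`
   specialisation is the existing fact, `dcp_reflectedGradient_lower_of_nearCritical`).
   Conclusion: Theorem 1.3 in the range its printed proof delivers, `N₁ ≤ n`, `4n ≤ L(β)` —
   verbatim the conclusion of `dcp_twoPoint_axis_lower_nearCritical.of_four_mul_le_sharpLength`
   (see the module docstring of `SharpLengthDCP.lean` for why the printed range `n ≤ L(β)` is not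
   what the printed proof gives). The proof is the printed one (p. 5), transcribed exactly as in
   `CriticalTwoPointDCPLowerFromReflected.lean` at `β_c`: Theorem 1.2 at scale `4n`, the halves
   `x₁ ≤ 2n` / `x₁ > 2n` bounded by the abstract lemmas `DCPBubble.firstHalf_le`,
   `DCPBubble.secondHalf_le`, `DCPBubble.tsum_shift_le` (Messager–Miracle-Solé + the gradient
   estimate (1.11)). What changes away from `β_c`, and why the constants stay uniform in `β`:
   * the gradient estimate (1.11) holds for every `β ≥ 0` with `m*(β) = 0`
     (`twoPointFree_gradient_estimate`, reflection positivity), and `m*(β) = 0` for `β < β_c`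
     (`spontaneousMagnetization_eq_zero_of_lt_criticalBeta_of_gks`) and at `β_c` for `d ≥ 3`
     (`spontaneousMagnetization_criticalBeta_eq_zero_holds`);
   * Messager–Miracle-Solé for the free state holds for every `β ≥ 0` (`messager_miracleSole_free`);
   * the additive constant of `tsum_shift_le` is absorbed with a lower bound on `⟨σ₀σ_{e₁}⟩_β`
     UNIFORM over the range: `4 ≤ 4n ≤ L(β)` makes `Λ₁ ∋ 0` (diameter `2`) inadmissible, so
     `1/2 ≤ φ_β(Λ₁) ≤ β · 2d · #Λ₁ · ⟨σ₀σ_{e₁}⟩_β` (`twoPointFree_single_one_lower`: Griffiths'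
     comparison `⟨σ₀σ_x⟩_{Λ₁,β} ≤ ⟨σ₀σ_x⟩_β` and Messager–Miracle-Solé `⟨σ₀σ_x⟩_β ≤ ⟨σ₀σ_{e₁}⟩_β`
     for `|x| = 1`), whence `⟨σ₀σ_{e₁}⟩_β ≥ 1/(4d #Λ₁ max(β_c,1))`;
   * the factor `β`: `c₀ ≤ β T` and `0 < β ≤ max(β_c, 1)` give `T ≥ c₀ / max(β_c, 1)`
     (`β > 0` because `2 ≤ L(β)` forces `β ≥ 1/(4d)`, `inv_le_of_two_le_sharpLength`).

## References

* H. Duminil-Copin, R. Panis, CMP 406 (2025), arXiv:2404.05700: Def. 1.1, eq. (1.4), Thm. 1.2,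
  Thm. 1.3 and its proof (p. 4–5 of the held arXiv text), proof of Thm. 1.8 (p. 7)
  [DuminilCopinPanis2025LowerBounds].
* B. Simon, CMP 77 (1980) 111 (lower bound `c/|x|^{d-1}` at `β_c`), as discharged in
  `CriticalTwoPointBounds.lean` [Simon1980].
* A. Messager, S. Miracle-Solé, J. Stat. Phys. 17 (1977) 245 [MessagerMiracleSoleJSP1977].
* S. Friedli, Y. Velenik, *Statistical Mechanics of Lattice Systems* (CUP 2017), Def. 3.32
  [FriedliVelenik2017]; M. Aizenman, H. Duminil-Copin, V. Sidoravicius, CMP 334 (2015), Thm. 1.2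
  [AizenmanDuminilCopinSidoraviciusCMP2015] (`m*(β) = 0` for `β ≤ β_c`, `d ≥ 3`).
-/

noncomputable section

open Finset Filter
open Literature.Probability.Percolation
open Literature.Barriers.CriticalPhenomena.DCPBubble
open scoped BigOperators Topology

namespace Literature.Probability.LatticeModels

variable {d : ℕ}

/-! ### `m*(β) = 0` on `[0, β_c]` in `d ≥ 3` -/

/-- `m*(β) = 0` for `0 ≤ β ≤ β_c` when `d ≥ 3`: below `β_c` by the definition of `β_c`
(`spontaneousMagnetization_eq_zero_of_lt_criticalBeta_of_gks`), at `β_c` by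
Aizenman–Duminil-Copin–Sidoravicius (`spontaneousMagnetization_criticalBeta_eq_zero_holds`). This is
the standing hypothesis of the gradient estimate `twoPointFree_gradient_estimate`. [cite: FriedliVelenik2017, Def. 3.32, eq. (3.27)] [cite: AizenmanDuminilCopinSidoraviciusCMP2015, Thm. 1.2 with Cor. 1.5 (1)] -/
theorem spontaneousMagnetization_eq_zero_of_le_criticalBeta (hd : 3 ≤ d) {β : ℝ} (hβ : 0 ≤ β)
    (hβc : β ≤ criticalBeta d) : spontaneousMagnetization d β = 0 := by
  rcases hβc.lt_or_eq with hlt | heq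
  · exact spontaneousMagnetization_eq_zero_of_lt_criticalBeta_of_gks
      (fun _ _ _ _ _ => GKSInequalities.gks_one_holds (zdGraph d)) hasBoxLimit_isingCorr_plus_holds
      hβ hlt
  · rw [heq]
    exact spontaneousMagnetization_criticalBeta_eq_zero_holds hd

/-! ### A lower bound on `⟨σ₀σ_{e₁}⟩_β`, uniform on `{β : L(β) ≥ 2}` -/

/-- **`⟨σ₀σ_{e₁}⟩_β` is bounded below in terms of the sharp length.** If `1 < L(β)` then the box
`Λ₁ ∋ 0` (sup-norm diameter `2`) is not a witness, so `φ_β(Λ₁) ≥ 1/2` (Def. 1.1); and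
`φ_β(Λ₁) = β ∑_{x ∈ Λ₁} #{y ∉ Λ₁ : y ∼ x} ⟨σ₀σ_x⟩_{Λ₁,β} ≤ β · 2d · #Λ₁ · ⟨σ₀σ_{e₁}⟩_β`, because a
site of `Λ₁` with a neighbour outside `Λ₁` is not the origin, `⟨σ₀σ_x⟩_{Λ₁,β} ≤ ⟨σ₀σ_x⟩_β`
(Griffiths) and `⟨σ₀σ_x⟩_β ≤ ⟨σ₀σ_{e₁}⟩_β` for `|x| = 1` (Messager–Miracle-Solé). [cite: DuminilCopinPanis2025LowerBounds, Definition 1.1] [cite: MessagerMiracleSoleJSP1977, main theorem (monotonicity of ⟨σ₀σ_x⟩ under reflections)] -/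
theorem twoPointFree_single_one_lower (hd : 1 ≤ d) {β : ℝ} (hβ : 0 ≤ β)
    (hL : (1 : ℕ∞) < sharpLength d β) :
    1 / 2 ≤ β * (2 * d * #(box d 1)) * twoPointFree d β (Pi.single (⟨0, by omega⟩ : Fin d) 1) := by
  have hgks : ∀ {Λ A : Finset (Site d)} {β h : ℝ} {bc : BoundaryCondition (Site d)},
      gks_one (zdGraph d) (Λ := Λ) (A := A) (β := β) (h := h) (bc := bc) :=
    GKSInequalities.gks_one_holds (zdGraph d)
  have hgks2 : ∀ (G' : SimpleGraph (Site d)) [G'.LocallyFinite] (Λ A B : Finset (Site d))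
      (β h : ℝ) (bc : BoundaryCondition (Site d)),
      gks_two G' (Λ := Λ) (A := A) (B := B) (β := β) (h := h) (bc := bc) :=
    fun G' _ _ _ _ _ _ _ => GKSInequalities.gks_two_holds G'
  have hlim : hasBoxLimit_isingCorr_free d := hasBoxLimit_isingCorr_free_holds
  have hmono : isingCorr_free_mono_volume (d := d) := isingCorr_free_mono_volume_of_gks_two hgks2
  set e : Site d := Pi.single (⟨0, by omega⟩ : Fin d) 1 with he
  have hφ : 1 / 2 ≤ dcpPhi d β (box d 1) :=
    half_le_dcpPhi_of_subset_box (k := 1) le_rfl (by exact_mod_cast hL) (zero_mem_box d 1)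
      subset_rfl
  have hGe0 : 0 ≤ twoPointFree d β e := twoPointFree_nonneg hlim hgks hβ e
  -- every term of `φ_β(Λ₁)` is at most `2d ⟨σ₀σ_{e₁}⟩_β`
  have hterm : ∀ x ∈ box d 1,
      ((((zdGraph d).neighborFinset x).filter fun y => y ∉ box d 1).card : ℝ) *
        isingTwoPoint (zdGraph d) (box d 1) β 0 .free 0 x ≤ 2 * d * twoPointFree d β e := by
    intro x hx
    by_cases hc : ((zdGraph d).neighborFinset x).filter (fun y => y ∉ box d 1) = ∅
    · rw [hc, card_empty, Nat.cast_zero, zero_mul]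
      positivity
    · obtain ⟨y, hy⟩ := nonempty_iff_ne_empty.2 hc
      rw [mem_filter, SimpleGraph.mem_neighborFinset] at hy
      -- `x` has a neighbour outside `Λ₁`, so `x ≠ 0` and `‖x‖_∞ = 1`
      have hx0 : x ≠ 0 := by
        rintro rfl
        apply hy.2
        rw [mem_box_iff_supNorm_le]
        have h1 := Site.supNorm_le_succ_of_adj hy.1
        rw [Site.supNorm_eq_zero_iff.2 rfl] at h1
        omega
      have hx1 : Site.supNorm x = 1 := by
        have h1 := mem_box_iff_supNorm_le.1 hx
        have h2 : Site.supNorm x ≠ 0 := fun h => hx0 (Site.supNorm_eq_zero_iff.1 h)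
        omega
      have hT : isingTwoPoint (zdGraph d) (box d 1) β 0 .free 0 x ≤ twoPointFree d β e := by
        refine (isingTwoPoint_free_le_twoPointFree hmono hlim hβ (zero_mem_box d 1) hx).trans ?_
        have h := twoPointFree_le_axis_of_mem_sphere' hβ hd (mem_sphere.2 hx1)
        simpa [he] using h
      have hcard : ((((zdGraph d).neighborFinset x).filter fun y => y ∉ box d 1).card : ℝ) ≤
          2 * d := by
        have h1 : (((zdGraph d).neighborFinset x).filter fun y => y ∉ box d 1).card ≤
            ((zdGraph d).neighborFinset x).card := card_filter_le _ _
        rw [card_neighborFinset_zdGraph_holds (d := d) x] at h1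
        exact_mod_cast h1
      have hT0 : 0 ≤ isingTwoPoint (zdGraph d) (box d 1) β 0 .free 0 x :=
        isingTwoPoint_free_nonneg hgks hβ (zero_mem_box d 1) hx
      exact mul_le_mul hcard hT hT0 (by positivity)
  have hsum : dcpPhi d β (box d 1) ≤ β * (2 * d * #(box d 1)) * twoPointFree d β e := by
    unfold dcpPhi
    calc β * ∑ x ∈ box d 1, ((((zdGraph d).neighborFinset x).filter fun y => y ∉ box d 1).card : ℝ) *
            isingTwoPoint (zdGraph d) (box d 1) β 0 .free 0 x
        ≤ β * ∑ _x ∈ box d 1, 2 * d * twoPointFree d β e :=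
          mul_le_mul_of_nonneg_left (sum_le_sum hterm) hβ
      _ = β * (2 * d * #(box d 1)) * twoPointFree d β e := by
          rw [sum_const, nsmul_eq_mul]
          ring
  exact hφ.trans hsum

/-! ### `L(β_c) = ∞` -/

/-- **`L(β_c) = ∞` for `d ≥ 3`.** If `L(β_c) = ℓ` were finite, eq. (1.4)
(`dcp_nearCritical_upper_holds`) would give `⟨σ₀σ_{ne₁}⟩_{β_c} ≤ C ℓ^{2-d} e^{-cn/ℓ} ≤ C e^{-cn/ℓ}`
for all `n ≥ ℓ`, while Simon's bound (`criticalTwoPoint_bounds_holds`, transported to the free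
state by `twoPointPlus_criticalBeta_eq_twoPointFree_holds`) gives
`⟨σ₀σ_{ne₁}⟩_{β_c} ≥ c' n^{1-d}`; but `n^{d-1} e^{-cn/ℓ} → 0`. (The source applies Theorem 1.2 at
`β_c` for all large `n`, proof of Theorem 1.8, p. 7, i.e. it uses `L(β_c) = ∞`.) [cite: DuminilCopinPanis2025LowerBounds, Definition 1.1 with eq. (1.4) and the display after eq. (1.3) (Simon's lower bound); proof of Theorem 1.8 (p. 7)] -/
theorem sharpLength_criticalBeta_eq_top (hd : 3 ≤ d) : sharpLength d (criticalBeta d) = ⊤ := by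
  by_contra hne
  obtain ⟨ℓ, hℓ⟩ := ENat.ne_top_iff_exists.1 hne
  obtain ⟨c, C, hc, hC, hup⟩ := dcp_nearCritical_upper_holds (d := d) hd
  obtain ⟨c', C', hc', hbd⟩ := criticalTwoPoint_bounds_holds (d := d) hd
  have hd1 : 0 < d := by omega
  set i : Fin d := ⟨0, hd1⟩ with hidef
  have hℓ1 : 1 ≤ ℓ := by
    have h := one_le_sharpLength (d := d) (β := criticalBeta d)
    rw [← hℓ] at h
    exact_mod_cast h
  have hℓpos : (0 : ℝ) < ℓ := by exact_mod_cast hℓ1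
  -- the two bounds along the axis, for `n ≥ ℓ`
  have hkey : ∀ n : ℕ, ℓ ≤ n → c' ≤ C * ((n : ℝ) ^ (d - 1) * Real.exp (-(c * n / ℓ))) := by
    intro n hn
    have hn1 : 1 ≤ n := hℓ1.trans hn
    have hnpos : (0 : ℝ) < n := by exact_mod_cast hn1
    set x : Site d := Pi.single i (n : ℤ) with hx
    have hx0 : x ≠ 0 := by
      intro h0
      have h0i := congrFun h0 i
      simp [hx] at h0i
      omega
    have hnorm : ‖x‖ = (n : ℝ) := by
      rw [hx, Pi.norm_single, Int.norm_natCast]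
    have hlow := (hbd x hx0).1
    have hfree : criticalTwoPoint d x = twoPointFree d (criticalBeta d) x :=
      twoPointPlus_criticalBeta_eq_twoPointFree_holds hd x
    have hupx := ((hup (criticalBeta d) (criticalBeta_nonneg d) le_rfl x hx0).2 ℓ hℓ.symm)
    rw [hfree, hnorm] at hlow
    rw [hnorm, min_eq_right (by exact_mod_cast hn : (ℓ : ℝ) ≤ n)] at hupx
    -- `c' n^{-(d-1)} = c' / n^{d-1}`
    have hrpow : (n : ℝ) ^ (-((d : ℝ) - 1)) = ((n : ℝ) ^ (d - 1))⁻¹ := by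
      rw [Real.rpow_neg hnpos.le, show ((d : ℝ) - 1) = ((d - 1 : ℕ) : ℝ) by
        rw [Nat.cast_sub (by omega : 1 ≤ d), Nat.cast_one], Real.rpow_natCast]
    rw [hrpow, ← div_eq_mul_inv, div_le_iff₀ (by positivity)] at hlow
    -- `(1/ℓ)^{d-2} ≤ 1`
    have hpow1 : (1 / (ℓ : ℝ)) ^ (d - 2) ≤ 1 :=
      pow_le_one₀ (by positivity) ((div_le_one hℓpos).2 (by exact_mod_cast hℓ1))
    have hexp0 : 0 ≤ Real.exp (-(c * n / ℓ)) := (Real.exp_pos _).le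
    calc c' ≤ twoPointFree d (criticalBeta d) x * (n : ℝ) ^ (d - 1) := hlow
      _ ≤ C * (1 / (ℓ : ℝ)) ^ (d - 2) * Real.exp (-(c * n / ℓ)) * (n : ℝ) ^ (d - 1) :=
          mul_le_mul_of_nonneg_right hupx (by positivity)
      _ ≤ C * 1 * Real.exp (-(c * n / ℓ)) * (n : ℝ) ^ (d - 1) := by
          gcongr
      _ = C * ((n : ℝ) ^ (d - 1) * Real.exp (-(c * n / ℓ))) := by ring
  -- but `n^{d-1} e^{-cn/ℓ} → 0`
  have hlim : Tendsto (fun n : ℕ => C * ((n : ℝ) ^ (d - 1) * Real.exp (-(c * n / ℓ)))) atTop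
      (𝓝 0) := by
    have h1 := Real.tendsto_pow_mul_exp_neg_atTop_nhds_zero (d - 1)
    have h2 : Tendsto (fun n : ℕ => c / ℓ * (n : ℝ)) atTop atTop :=
      Tendsto.const_mul_atTop (by positivity) tendsto_natCast_atTop_atTop
    have h3 := (h1.comp h2).const_mul (C * ((ℓ : ℝ) / c) ^ (d - 1))
    rw [mul_zero] at h3
    refine h3.congr fun n => ?_
    simp only [Function.comp]
    have hcl : (ℓ : ℝ) / c * (c / ℓ) = 1 := by field_simp
    calc C * ((ℓ : ℝ) / c) ^ (d - 1) * ((c / ℓ * n) ^ (d - 1) * Real.exp (-(c / ℓ * n)))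
        = C * (((ℓ : ℝ) / c * (c / ℓ)) ^ (d - 1) * (n : ℝ) ^ (d - 1) *
            Real.exp (-(c / ℓ * n))) := by rw [mul_pow, mul_pow]; ring
      _ = C * ((n : ℝ) ^ (d - 1) * Real.exp (-(c * n / ℓ))) := by
          rw [hcl, one_pow, one_mul, show c / ℓ * (n : ℝ) = c * n / ℓ by ring]
  obtain ⟨n, hnlt, hnℓ⟩ := ((hlim.eventually_lt_const hc').and (eventually_ge_atTop ℓ)).exists
  exact absurd (hkey n hnℓ) (not_le.2 hnlt)

/-- **The `β = β_c` slice of the near-critical Theorem 1.3 is the critical Theorem 1.3,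
unconditionally** (the hypothesis `L(β_c) = ⊤` of `dcp_criticalTwoPoint_axis_lower_of_nearCritical`
discharged by `sharpLength_criticalBeta_eq_top`). [cite: DuminilCopinPanis2025LowerBounds, Theorem 1.3] -/
theorem dcp_criticalTwoPoint_axis_lower_of_nearCritical'
    (h : dcp_twoPoint_axis_lower_nearCritical (d := d)) :
    dcp_criticalTwoPoint_axis_lower (d := d) := by
  intro hd
  exact dcp_criticalTwoPoint_axis_lower_of_nearCritical h (sharpLength_criticalBeta_eq_top hd) hd

/-! ### Theorem 1.3 from Theorem 1.2: the bookkeeping, for an abstract two-point function -/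

/-- **The printed deduction "Theorem 1.2 at scale `4n` ⟹ Theorem 1.3 at scale `n`", for an
abstract lattice function.** Let `G : ℤ^d → [0,1]` be even, nonincreasing along the axis `e_i` on
`{x_i ≥ 0}` (Messager–Miracle-Solé), obey the gradient estimate (1.11)
`G(x) - G(x + e_i) ≤ G(je_i)/(x_i - j + 1)` (`0 ≤ j ≤ x_i`), with `G(0) = 1` and
`G(e_i) ≥ 1/K > 0`. If the reflected sum of Theorem 1.2 at scale `4n` (`n ≥ 1`) is `≥ c`, then
`G(ne_i) ≥ (c / (2d · 2·9^{d-1}(K+18))) / (∑_{x ∈ Λ_{4n}} G(x) + n^{d-2} ∑_{1≤k≤2n} k G(ke_i))`.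
This is the proof of Theorem 1.3 (p. 5) verbatim — the halves `x_i ≤ 2n` / `x_i > 2n`
(`DCPBubble.firstHalf_le`, `DCPBubble.secondHalf_le`, `DCPBubble.tsum_shift_le`), the axis sum
shortened to `k ≤ 2n` (`sum_range_mul_le_nine_mul_sum_Icc`), the additive constant absorbed by
`G(e_i) ≥ 1/K` — as transcribed at `β_c` in `CriticalTwoPointDCPLowerFromReflected.lean`, with the
constants made explicit so that they can be chosen uniformly in `β`. [cite: DuminilCopinPanis2025LowerBounds, proof of Theorem 1.3 (§1.1, p. 5)] -/
theorem DCPNearCritical.axis_lower_of_le_sum {G : Site d → ℝ} {i : Fin d} (hd : 3 ≤ d)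
    (hG0 : ∀ x, 0 ≤ G x) (hG1 : ∀ x, G x ≤ 1) (hGev : ∀ x : Site d, G (-x) = G x)
    (hmono : ∀ x : Site d, 0 ≤ x i → G (x + Pi.single i 1) ≤ G x)
    (hgrad : ∀ (x : Site d) (j : ℕ), (j : ℤ) ≤ x i →
      G x - G (x + Pi.single i 1) ≤ G (Pi.single i (j : ℤ)) / ((x i : ℝ) - j + 1))
    (hG00 : G 0 = 1) {K : ℝ} (hK0 : 0 < K) (hgK : K⁻¹ ≤ G (Pi.single i 1)) {c : ℝ} {n : ℕ}
    (hn1 : 1 ≤ n)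
    (hT : c ≤ ∑ x ∈ box d (4 * n), ∑ y ∈ (box d (4 * n)).filter (fun y => (zdGraph d).Adj x y),
      (G x - G (axisRefl i (2 * (4 * n : ℕ)) x)) * G (y - axisRefl i (2 * (4 * n : ℕ)) y)) :
    c / (2 * d * (2 * 9 ^ (d - 1) * (K + 18))) /
        ((∑ x ∈ box d (4 * n), G x) +
          (n : ℝ) ^ (d - 2) * ∑ k ∈ Icc 1 (2 * n), (k : ℝ) * G (Pi.single i (k : ℤ)))
      ≤ G (Pi.single i (n : ℤ)) := by
  have hd1 : 0 < d := by omega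
  have hdpos : (0 : ℝ) < d := by exact_mod_cast hd1
  have hnpos : (0 : ℝ) < n := by exact_mod_cast hn1
  -- the constant `M = 2 · 9^{d-1} (K + 18) ≥ 1`
  obtain ⟨M, hMdef⟩ : ∃ M : ℝ, M = 2 * 9 ^ (d - 1) * (K + 18) := ⟨_, rfl⟩
  have hM1 : 1 ≤ M := by
    have h9 : (1 : ℝ) ≤ 9 ^ (d - 1) := one_le_pow₀ (by norm_num)
    rw [hMdef]; nlinarith
  rw [← hMdef]
  have hmonoAxis : ∀ k : ℕ, G (Pi.single i ((k + 1 : ℕ) : ℤ)) ≤ G (Pi.single i (k : ℤ)) := by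
    intro k
    have hk := hmono (Pi.single i (k : ℤ)) (by simp)
    rw [← Pi.single_add] at hk
    push_cast
    exact hk
  have hg1 : 0 < G (Pi.single i 1) := lt_of_lt_of_le (inv_pos.2 hK0) hgK
  have hg1inv : (G (Pi.single i 1))⁻¹ ≤ K := inv_le_of_inv_le₀ hK0 hgK
  -- split into the two halves
  rw [← sum_filter_add_sum_filter_not (box d (4 * n)) (fun x : Site d => 2 * x i ≤ ((4 * n : ℕ) : ℤ))]
    at hT
  have h1 := firstHalf_le (G := G) (i := i) hG0 hGev hmono (n := 4 * n) (by omega)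
  have h2 := secondHalf_le (G := G) (i := i) hG0 hGev hmono hgrad (4 * n)
  have h3 := tsum_shift_le (G := G) (i := i) hG1 hG0 hmono (4 * n)
  -- first half: `G((4n-2)e_i) ≤ G(n e_i)`
  have hA : G (Pi.single i (((4 * n : ℕ) : ℤ) - 2)) ≤ G (Pi.single i (n : ℤ)) :=
    axis_le_axis hmono (by positivity) (by push_cast; omega)
  have ha0 : 0 ≤ G (Pi.single i (n : ℤ)) := hG0 _
  have hχ0 : 0 ≤ ∑ x ∈ box d (4 * n), G x := sum_nonneg fun x _ => hG0 x
  have hχ1 : 1 ≤ ∑ x ∈ box d (4 * n), G x := by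
    have hle := single_le_sum (f := G) (fun x _ => hG0 x) (zero_mem_box d (4 * n))
    rwa [hG00] at hle
  have hfirst := h1.trans
    (mul_le_mul_of_nonneg_right (mul_le_mul_of_nonneg_left hA (by positivity)) hχ0)
  -- second half: `⌊4n/4⌋ = n`, the axis sum shortened to `k ≤ 2n`, the constant absorbed
  have hm4 : ((4 * n : ℕ) / 4 : ℕ) = n := by omega
  rw [hm4] at h2
  have hW0 : 0 ≤ ∑ k ∈ Icc 1 (2 * n), (k : ℝ) * G (Pi.single i (k : ℤ)) :=
    sum_nonneg fun k _ => mul_nonneg (Nat.cast_nonneg k) (hG0 _)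
  have hWg : G (Pi.single i 1) ≤ ∑ k ∈ Icc 1 (2 * n), (k : ℝ) * G (Pi.single i (k : ℤ)) := by
    have hmem : (1 : ℕ) ∈ Icc 1 (2 * n) := by rw [mem_Icc]; omega
    have hle := single_le_sum (f := fun k : ℕ => (k : ℝ) * G (Pi.single i (k : ℤ)))
      (fun k _ => mul_nonneg (Nat.cast_nonneg k) (hG0 _)) hmem
    simpa using hle
  have h9 := sum_range_mul_le_nine_mul_sum_Icc (g := fun k : ℕ => G (Pi.single i (k : ℤ)))
    (fun k => hG0 _) hmonoAxis n
  have hS : ∑ t ∈ range (4 * n + 1), (t : ℝ) * G (Pi.single i (2 * (t : ℤ) - 2)) ≤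
      (K + 18) * ∑ k ∈ Icc 1 (2 * n), (k : ℝ) * G (Pi.single i (k : ℤ)) := by
    refine le_trans ?_ ((one_add_mul_le_inv_add_mul hg1 hWg).trans
      (mul_le_mul_of_nonneg_right (by linarith) hW0))
    linarith [h3, h9]
  have hpow : (2 * ((4 * n : ℕ) : ℝ) + 1) ^ (d - 1) * (8 / ((4 * n : ℕ) : ℝ)) ≤
      2 * 9 ^ (d - 1) * (n : ℝ) ^ (d - 2) := by
    obtain ⟨e, he⟩ : ∃ e, d - 1 = e + 1 := ⟨d - 2, by omega⟩
    have hde : d - 2 = e := by omega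
    rw [he, hde]
    push_cast
    have hn1' : (1 : ℝ) ≤ n := by exact_mod_cast hn1
    have hle : (2 * (4 * (n : ℝ)) + 1) ≤ 9 * n := by linarith
    have hb : (2 * (4 * (n : ℝ)) + 1) ^ (e + 1) ≤ (9 * n) ^ (e + 1) :=
      pow_le_pow_left₀ (by positivity) hle _
    calc (2 * (4 * (n : ℝ)) + 1) ^ (e + 1) * (8 / (4 * (n : ℝ)))
        ≤ (9 * n) ^ (e + 1) * (8 / (4 * (n : ℝ))) := by gcongr
      _ = 2 * 9 ^ (e + 1) * (n : ℝ) ^ e := by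
          field_simp
          ring
  have hP0 : 0 ≤ (n : ℝ) ^ (d - 2) * ∑ k ∈ Icc 1 (2 * n), (k : ℝ) * G (Pi.single i (k : ℤ)) :=
    mul_nonneg (by positivity) hW0
  have hSn0 : 0 ≤ ∑ t ∈ range (4 * n + 1), (t : ℝ) * G (Pi.single i (2 * (t : ℤ) - 2)) :=
    sum_nonneg fun t _ => mul_nonneg (Nat.cast_nonneg t) (hG0 _)
  have hsecond : ∑ x ∈ (box d (4 * n)).filter (fun x : Site d => ¬ 2 * x i ≤ ((4 * n : ℕ) : ℤ)),
      ∑ y ∈ (box d (4 * n)).filter (fun y => (zdGraph d).Adj x y),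
        (G x - G (axisRefl i (2 * (4 * n : ℕ)) x)) * G (y - axisRefl i (2 * (4 * n : ℕ)) y) ≤
      2 * d * G (Pi.single i (n : ℤ)) *
        (M * ((n : ℝ) ^ (d - 2) * ∑ k ∈ Icc 1 (2 * n), (k : ℝ) * G (Pi.single i (k : ℤ)))) := by
    refine h2.trans ?_
    calc 2 * d * (2 * ((4 * n : ℕ) : ℝ) + 1) ^ (d - 1) * (8 / ((4 * n : ℕ) : ℝ) * G (Pi.single i (n : ℤ))) *
          ∑ t ∈ range (4 * n + 1), (t : ℝ) * G (Pi.single i (2 * (t : ℤ) - 2))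
        = 2 * d * G (Pi.single i (n : ℤ)) *
            (((2 * ((4 * n : ℕ) : ℝ) + 1) ^ (d - 1) * (8 / ((4 * n : ℕ) : ℝ))) *
              ∑ t ∈ range (4 * n + 1), (t : ℝ) * G (Pi.single i (2 * (t : ℤ) - 2))) := by ring
      _ ≤ 2 * d * G (Pi.single i (n : ℤ)) *
            ((2 * 9 ^ (d - 1) * (n : ℝ) ^ (d - 2)) *
              ((K + 18) * ∑ k ∈ Icc 1 (2 * n), (k : ℝ) * G (Pi.single i (k : ℤ)))) :=
          mul_le_mul_of_nonneg_left (mul_le_mul hpow hS hSn0 (by positivity))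
            (mul_nonneg (mul_nonneg zero_le_two hdpos.le) ha0)
      _ = 2 * d * G (Pi.single i (n : ℤ)) *
            (M * ((n : ℝ) ^ (d - 2) * ∑ k ∈ Icc 1 (2 * n), (k : ℝ) * G (Pi.single i (k : ℤ)))) := by
          rw [hMdef]; ring
  -- assemble
  exact div_div_le_of_halves hT hfirst hsecond hM1 hχ1 ha0 hdpos hP0

/-! ### Theorem 1.3 from Theorem 1.2, near-critical -/

/-- **Duminil-Copin–Panis 2025, Theorem 1.3 from Theorem 1.2, for all `β ≤ β_c`** (nearest-
neighbour Ising model on `ℤ^d`, `d ≥ 3`). Hypothesis: Theorem 1.2 as printed — "there exist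
`c₀, N₀ > 0` such that for all `β ≤ β_c` and for all `N₀ ≤ n ≤ L(β)`,
`β ∑_{x,y ∈ Λ_n, y ∼ x} (⟨τ₀τ_x⟩_β - ⟨τ₀τ_{𝓡_n(x)}⟩_β)⟨τ_yτ_{𝓡_n(y)}⟩_β ≥ c₀`" — in the rendering of
the tree's `β_c` fact `dcp_reflectedGradient_lower`, for `0 ≤ β ≤ β_c` and `(n : ℕ∞) ≤ L(β)`.
Conclusion: Theorem 1.3 in the range `N₁ ≤ n`, `4n ≤ L(β)` which its printed proof ("from which
the proof follows readily", i.e. Theorem 1.2 at scale `4n`) establishes: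
`⟨σ₀σ_{ne₁}⟩_β ≥ c₁ / (χ_{4n}(β) + n^{d-2} ∑_{1 ≤ k ≤ 2n} k⟨σ₀σ_{ke₁}⟩_β)` — the conclusion of
`dcp_twoPoint_axis_lower_nearCritical.of_four_mul_le_sharpLength`, character for character.
Proof: `DCPNearCritical.axis_lower_of_le_sum` for `G = ⟨σ₀σ_·⟩_β`, whose hypotheses hold
uniformly in `0 ≤ β ≤ β_c`: GKS (`0 ≤ G ≤ 1`, `G(0) = 1`), evenness, Messager–Miracle-Solé for the
free state (`messager_miracleSole_free`), the gradient estimate (1.11) for `m*(β) = 0`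
(`twoPointFree_gradient_estimate`, `spontaneousMagnetization_eq_zero_of_le_criticalBeta`), and
`⟨σ₀σ_{e₁}⟩_β ≥ 1/K`, `K = 4d #Λ₁ max(β_c,1)` (`twoPointFree_single_one_lower`, using
`4 ≤ 4n ≤ L(β)`); the printed factor `β` costs `max(β_c, 1)` (`β > 0` because `2 ≤ L(β)` forces
`β ≥ 1/(4d)`, `inv_le_of_two_le_sharpLength`). [cite: DuminilCopinPanis2025LowerBounds, Theorem 1.3 and its proof (§1.1, p. 5), with Theorem 1.2] -/
theorem dcp_twoPoint_axis_lower_of_reflectedGradient_nearCritical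
    (h12 : ∀ (hd : 3 ≤ d), ∃ c₀ : ℝ, 0 < c₀ ∧ ∃ N₀ : ℕ, 0 < N₀ ∧ ∀ β : ℝ, 0 ≤ β →
      β ≤ criticalBeta d → ∀ n : ℕ, N₀ ≤ n → (n : ℕ∞) ≤ sharpLength d β →
        c₀ ≤ β * ∑ x ∈ box d n, ∑ y ∈ box d n,
          if (zdGraph d).Adj x y then
            (twoPointFree d β x - twoPointFree d β (dcpReflect (⟨0, by omega⟩ : Fin d) (n : ℤ) x)) *
              freeExpect d β 0 (spinPair y (dcpReflect (⟨0, by omega⟩ : Fin d) (n : ℤ) y))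
          else 0) :
    ∀ (hd : 3 ≤ d), ∃ c₁ : ℝ, 0 < c₁ ∧ ∃ N₁ : ℕ, 0 < N₁ ∧ ∀ β : ℝ, 0 ≤ β → β ≤ criticalBeta d →
      ∀ n : ℕ, N₁ ≤ n → ((4 * n : ℕ) : ℕ∞) ≤ sharpLength d β →
        c₁ / ((∑ x ∈ box d (4 * n), twoPointFree d β x) +
              (n : ℝ) ^ (d - 2) *
                ∑ k ∈ Finset.Icc 1 (2 * n),
                  (k : ℝ) * twoPointFree d β (Pi.single (⟨0, by omega⟩ : Fin d) (k : ℤ)))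
          ≤ twoPointFree d β (Pi.single (⟨0, by omega⟩ : Fin d) (n : ℤ)) := by
  intro hd
  have hd1 : 0 < d := by omega
  set i : Fin d := ⟨0, hd1⟩ with hidef
  have hdpos : (0 : ℝ) < d := by exact_mod_cast hd1
  obtain ⟨c₀, hc₀, N₀, hN₀, hmain⟩ := h12 hd
  -- constants, uniform in `β`
  set B : ℝ := max (criticalBeta d) 1 with hBdef
  have hB1 : 1 ≤ B := le_max_right _ _
  have hB0 : 0 < B := one_pos.trans_le hB1
  have hcard0 : (0 : ℝ) < #(box d 1) := by exact_mod_cast card_pos.2 ⟨0, zero_mem_box d 1⟩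
  set K : ℝ := 4 * d * #(box d 1) * B with hKdef
  have hK0 : 0 < K := mul_pos (mul_pos (mul_pos four_pos hdpos) hcard0) hB0
  have hden : 0 < 2 * d * (2 * 9 ^ (d - 1) * (K + 18)) := by positivity
  refine ⟨c₀ / B / (2 * d * (2 * 9 ^ (d - 1) * (K + 18))), div_pos (div_pos hc₀ hB0) hden,
    max N₀ 1, lt_max_of_lt_right one_pos, fun β hβ hβc n hn h4n => ?_⟩
  have hnN : N₀ ≤ n := le_of_max_le_left hn
  have hn1 : 1 ≤ n := le_of_max_le_right hn
  -- consequences of the range `4 ≤ 4n ≤ L(β)`: `β > 0`, and `Λ₁` is not a witness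
  have hL2 : (2 : ℕ∞) ≤ sharpLength d β :=
    le_trans (by exact_mod_cast (show 2 ≤ 4 * n by omega)) h4n
  have hL1 : (1 : ℕ∞) < sharpLength d β :=
    lt_of_lt_of_le (by exact_mod_cast (show 1 < 4 * n by omega)) h4n
  have hβpos : 0 < β := lt_of_lt_of_le (by positivity) (inv_le_of_two_le_sharpLength hL2)
  have hβB : β ≤ B := hβc.trans (le_max_left _ _)
  set G : Site d → ℝ := twoPointFree d β with hG
  -- inputs: GKS, Messager–Miracle-Solé, evenness, the gradient estimate (1.11) at `β`
  have hG0 : ∀ x, 0 ≤ G x := fun x =>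
    twoPointFree_nonneg hasBoxLimit_isingCorr_free_holds (GKSInequalities.gks_one_holds (zdGraph d)) hβ x
  have hG1 : ∀ x, G x ≤ 1 := fun x => twoPointFree_le_one hasBoxLimit_isingCorr_free_holds hβ x
  have hGev : ∀ x : Site d, G (-x) = G x := fun x => by
    simp only [hG]
    rw [← twoPointFree_abs_eq hβ (-x), ← twoPointFree_abs_eq hβ x]
    simp [abs_neg]
  have hmono : ∀ x : Site d, 0 ≤ x i → G (x + Pi.single i 1) ≤ G x := fun x hx =>
    messager_miracleSole_free hβ x i hx
  have hm : spontaneousMagnetization d β = 0 :=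
    spontaneousMagnetization_eq_zero_of_le_criticalBeta hd hβ hβc
  have hgrad : ∀ (x : Site d) (j : ℕ), (j : ℤ) ≤ x i →
      G x - G (x + Pi.single i 1) ≤ G (Pi.single i (j : ℤ)) / ((x i : ℝ) - j + 1) :=
    fun x j hj => twoPointFree_gradient_estimate hβ hm i x j hj
  have hG00 : G 0 = 1 := twoPointFree_zero' β
  -- `⟨σ₀σ_{e₁}⟩_β ≥ 1/K`, uniformly in `β`
  have hgK : K⁻¹ ≤ G (Pi.single i 1) := by
    have h : 1 / 2 ≤ β * (2 * d * #(box d 1)) * G (Pi.single i 1) :=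
      twoPointFree_single_one_lower (by omega : 1 ≤ d) hβ hL1
    have hprod : β * (2 * d * #(box d 1)) ≤ K / 2 :=
      calc β * (2 * d * #(box d 1)) ≤ B * (2 * d * #(box d 1)) :=
            mul_le_mul_of_nonneg_right hβB (by positivity)
        _ = K / 2 := by rw [hKdef]; ring
    have h2 : 1 / 2 ≤ K / 2 * G (Pi.single i 1) :=
      h.trans (mul_le_mul_of_nonneg_right hprod (hG0 _))
    rw [inv_le_iff_one_le_mul₀ hK0]
    linarith
  -- Theorem 1.2 at `m = 4n` (printed range `4n ≤ L(β)`); the factor `β` costs `B`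
  have h4 := hmain β hβ hβc (4 * n) (by omega) h4n
  have h4' := (div_le_iff₀' hβpos).2 h4
  have hT : c₀ / B ≤ ∑ x ∈ box d (4 * n), ∑ y ∈ (box d (4 * n)).filter (fun y => (zdGraph d).Adj x y),
      (G x - G (axisRefl i (2 * (4 * n : ℕ)) x)) * G (y - axisRefl i (2 * (4 * n : ℕ)) y) := by
    refine ((div_le_div_of_nonneg_left hc₀.le hβpos hβB).trans h4').trans_eq ?_
    refine Finset.sum_congr rfl fun x _ => ?_
    rw [Finset.sum_filter]
    refine Finset.sum_congr rfl fun y _ => ?_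
    split_ifs with hxy
    · have hpair : freeExpect d β 0 (spinPair y (dcpReflect i ((4 * n : ℕ) : ℤ) y)) =
          G (y - dcpReflect i ((4 * n : ℕ) : ℤ) y) := by
        have h1 : freeExpect d β 0 (spinPair y (dcpReflect i ((4 * n : ℕ) : ℤ) y)) =
            twoPointFree d β (dcpReflect i ((4 * n : ℕ) : ℤ) y - y) :=
          freePair_eq_twoPointFree_sub hβ y _
        rw [h1, ← hGev]
        congr 1
        abel
      have hR : ∀ z : Site d, dcpReflect i ((4 * n : ℕ) : ℤ) z = axisRefl i (2 * (4 * n : ℕ)) z := by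
        intro z
        funext j
        rw [dcpReflect, Function.update_apply, axisRefl_apply]
      rw [hpair, hR, hR]
    · rfl
  exact DCPNearCritical.axis_lower_of_le_sum hd hG0 hG1 hGev hmono hgrad hG00 hK0 hgK hn1 hT

/-- **The `β = β_c` slice**: Theorem 1.2 in the near-critical range (hypothesis as above) already
implies the tree's critical Theorem 1.3, `dcp_criticalTwoPoint_axis_lower`, because `L(β_c) = ∞`
(`sharpLength_criticalBeta_eq_top`) puts every `n ≥ N₁` in the range `4n ≤ L(β_c)`. [cite: DuminilCopinPanis2025LowerBounds, Theorem 1.3 with Theorem 1.2] -/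
theorem dcp_criticalTwoPoint_axis_lower_of_reflectedGradient_nearCritical
    (h12 : ∀ (hd : 3 ≤ d), ∃ c₀ : ℝ, 0 < c₀ ∧ ∃ N₀ : ℕ, 0 < N₀ ∧ ∀ β : ℝ, 0 ≤ β →
      β ≤ criticalBeta d → ∀ n : ℕ, N₀ ≤ n → (n : ℕ∞) ≤ sharpLength d β →
        c₀ ≤ β * ∑ x ∈ box d n, ∑ y ∈ box d n,
          if (zdGraph d).Adj x y then
            (twoPointFree d β x - twoPointFree d β (dcpReflect (⟨0, by omega⟩ : Fin d) (n : ℤ) x)) *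
              freeExpect d β 0 (spinPair y (dcpReflect (⟨0, by omega⟩ : Fin d) (n : ℤ) y))
          else 0) :
    dcp_criticalTwoPoint_axis_lower (d := d) := by
  intro hd
  obtain ⟨c₁, hc₁, N₁, hN₁, h⟩ := dcp_twoPoint_axis_lower_of_reflectedGradient_nearCritical h12 hd
  refine ⟨c₁, hc₁, N₁, hN₁, fun n hn => h (criticalBeta d) (criticalBeta_nonneg d) le_rfl n hn ?_⟩
  rw [sharpLength_criticalBeta_eq_top hd]
  exact le_top

/-- **Consistency of the hypothesis with the tree's `β_c` fact**: Theorem 1.2 in the near-critical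
range (hypothesis as above) specialises at `β = β_c`, `L(β_c) = ∞`, to `dcp_reflectedGradient_lower`
(where the factor `β_c` is absorbed into the constant: `c₀ ≤ β_c T` gives `T ≥ c₀ / max(β_c, 1)`).
[cite: DuminilCopinPanis2025LowerBounds, Theorem 1.2] -/
theorem dcp_reflectedGradient_lower_of_nearCritical
    (h12 : ∀ (hd : 3 ≤ d), ∃ c₀ : ℝ, 0 < c₀ ∧ ∃ N₀ : ℕ, 0 < N₀ ∧ ∀ β : ℝ, 0 ≤ β →
      β ≤ criticalBeta d → ∀ n : ℕ, N₀ ≤ n → (n : ℕ∞) ≤ sharpLength d β →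
        c₀ ≤ β * ∑ x ∈ box d n, ∑ y ∈ box d n,
          if (zdGraph d).Adj x y then
            (twoPointFree d β x - twoPointFree d β (dcpReflect (⟨0, by omega⟩ : Fin d) (n : ℤ) x)) *
              freeExpect d β 0 (spinPair y (dcpReflect (⟨0, by omega⟩ : Fin d) (n : ℤ) y))
          else 0) :
    dcp_reflectedGradient_lower (d := d) := by
  intro hd
  obtain ⟨c₀, hc₀, N₀, hN₀, h⟩ := h12 hd
  refine ⟨c₀ / max (criticalBeta d) 1, by positivity, N₀, hN₀, fun n hn => ?_⟩
  have hmain := h (criticalBeta d) (criticalBeta_nonneg d) le_rfl n hn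
    (by rw [sharpLength_criticalBeta_eq_top hd]; exact le_top)
  have hB0 : 0 < max (criticalBeta d) 1 := lt_max_of_lt_right one_pos
  rcases (criticalBeta_nonneg d).lt_or_eq with hpos | hzero
  · have h1 := (div_le_iff₀' hpos).2 hmain
    exact (div_le_div_of_nonneg_left hc₀.le hpos (le_max_left _ _)).trans h1
  · rw [← hzero, zero_mul] at hmain
    exact absurd hmain (not_le.2 hc₀)

end Literature.Probability.LatticeModels

end
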